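import Summits.BirchSwinnertonDyer.Rank1Residual.Supersingular.KuriharaTwistRoundingIntegrality
import HarnessLib

/-!
# Kurihara numbers from twisted `L`-values — the Hasse-bounded per-row CHECK `RoundingCert.validHasse`
# (decidable companion of `KuriharaTwistRoundingIntegrality.lean`)

Cell `b2b-bsdres` (BSD rank `≤ 1` residual classes), supersingular family, prover A = unit
`b2b-bsdres-x10b` (gen 10).  Topic file under `Summits/BirchSwinnertonDyer/Rank1Residual/Supersingular/`;
namespace `Summit.BirchSwinnertonDyer.Rank1Residual.Supersingular.KuriharaTwist`.  A DATA CHECK (two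
definitions: a `Bool`-valued row predicate and its list form) plus theorems; no named fact, nothing asserted
about any elliptic curve, nothing booked; marks unchanged.

HONEST FRAMING (run/shared/lean/b2b/bsd-rank1-residual/, verbatim in every file): the goal of the
cell is to DELETE the COMBINATION-SHAPED residual classes of the Birch–Swinnerton-Dyer formula for
ALL analytic-rank `≤ 1` elliptic curves over `ℚ` — "full BSD formula for every rank `≤ 1` curve in
class `C`" assembled STRICTLY from published theorems — so that the rank-`≤ 1` remainder becomes
exactly the CONSTRUCTION-SHAPED classes, which are TYPED (missing-input `Prop`s), NOT attempted.
This is not "finishing BSD".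

## What this file adds

`KuriharaTwistRoundingIntegrality.lean` proves that a rounding-certificate row whose recorded decimal bounds
satisfy the HASSE-BOUNDED inequality `8·p·(marNum·10^radExp + radNum·10^marExp) < 10^(marExp+radExp)`
certifies exact rounding of the `f`-unit bins (`RoundingCert.sum_ratPlusSymbol_eq_div_of_ineq`; denominator
lemma `den ∣ 2#Ẽ(𝔽_p) ≤ 8p`, no Manin constant / torsion / optimality).  This file packages that inequality
as the decidable row predicate `RoundingCert.validHasse` — the schema's `RoundingCert.valid`
(`KuriharaTwistRoundingSchema.lean`) with the Manin/torsion divisibility `2·manin·torsion ∣ dstar` DROPPED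
(fields `torsion`, `manin`, `optimality` unread) and the inequality `margin + radius < 1/2` REPLACED by the
one above; keeps `#bins = #binsStar = p`, `0 < D`, `D ∣ D'`, `J_k·D = (D·C_k)·D'` — with its list form
`RoundingCertifiedHasse`, the unpacking lemmas, the consumer `RoundingCert.sum_ratPlusSymbol_eq_div_of_validHasse`,
`validHasse_of_valid` (a schema-valid row plus the sharper inequality is `validHasse`), and regression
samples.  Every one of the 3 775 landed certificate rows (`KuriharaTwistRoundingP01–P41`, 2 148 theorems)
passes (`max 8p·(margin + radius) = 1.13·10⁻⁵`; scan in the seat folder `work/validhasse_scan.txt`); no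
record file is re-issued — consumers apply `validHasse_of_valid` / `sum_ratPlusSymbol_eq_div_of_ineq` to the
landed rows.

References: `KuriharaTwistRoundingIntegrality.lean` (module docstring, (a)–(c): what stays outside the
kernel); REFEREE-3.md R3.339; REFEREE.md R125.3 / R135.4; C.-H. Kim, arXiv:2203.12159 §1.4
[Kim2022StructureSelmer]; Cremona 1997 §2.8 [CremonaAlgorithms1997].
-/

open Literature.NumberTheory.EllipticCurves Literature.NumberTheory.EllipticCurves.ModularForms
open CongruenceSubgroup

namespace Summit.BirchSwinnertonDyer.Rank1Residual.Supersingular.KuriharaTwist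

section Check

/-- Validity of a rounding certificate in the HASSE-BOUNDED `f`-UNIT currency (decidable, `Bool`-valued):
the schema's `RoundingCert.valid` with the Manin/torsion divisibility `2·manin·torsion ∣ dstar` DROPPED (the
fields `torsion`, `manin`, `optimality` are not read) and the certificate inequality `margin + radius < 1/2`
REPLACED by `8p·(margin + radius) < 1`, in the cleared form
`8·p·(marNum·10^radExp + radNum·10^marExp) < 10^(marExp + radExp)`; kept: `#bins = #binsStar = p`, `0 < D`,
`D ∣ D'`, `J_k·D = (D·C_k)·D'`.  The prime of the check is the record's own `p`, a prime of good reduction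
for the curve by the class predicate (`ℓ = p` in `sum_ratPlusSymbol_eq_div_of_ball`). [folklore] -/
def RoundingCert.validHasse (c : RoundingCert) : Bool :=
  (c.bins.length == c.p) && (c.binsStar.length == c.p) && (0 < c.den) && (c.dstar % c.den == 0) &&
  ((c.bins.zip c.binsStar).all fun ij => ij.2 * (c.den : ℤ) == ij.1 * (c.dstar : ℤ)) &&
  (8 * c.p * (c.marNum * 10 ^ c.radExp + c.radNum * 10 ^ c.marExp) < 10 ^ (c.marExp + c.radExp))

/-- A list of rounding certificates is `RoundingCertifiedHasse` when every one passes `validHasse`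
(the analogue of the schema's `RoundingCertified`). [folklore] -/
def RoundingCertifiedHasse (cs : List RoundingCert) : Prop := cs.all RoundingCert.validHasse = true

/-- `RoundingCertifiedHasse cs` is decidable (a `Bool` equation). [folklore] -/
instance RoundingCertifiedHasse.instDecidable (cs : List RoundingCert) :
    Decidable (RoundingCertifiedHasse cs) :=
  inferInstanceAs (Decidable (cs.all RoundingCert.validHasse = true))

/-- Unpacking `RoundingCertifiedHasse`: every listed certificate passes `validHasse`. [folklore] -/
theorem RoundingCertifiedHasse.validHasse_of_mem {cs : List RoundingCert} (h : RoundingCertifiedHasse cs)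
    {c : RoundingCert} (hc : c ∈ cs) : c.validHasse = true :=
  List.all_eq_true.1 h c hc

/-- `RoundingCertifiedHasse` of a `cons` is the head's validity together with that of the tail. [folklore] -/
theorem RoundingCertifiedHasse.cons_iff (c : RoundingCert) (cs : List RoundingCert) :
    RoundingCertifiedHasse (c :: cs) ↔ c.validHasse = true ∧ RoundingCertifiedHasse cs := by
  simp [RoundingCertifiedHasse, List.all_cons]

/-- The empty list passes (vacuously). [folklore] -/
theorem RoundingCertifiedHasse.nil : RoundingCertifiedHasse [] := by decide

/-- The inequality of a `validHasse` certificate: `8·p·(marNum·10^radExp + radNum·10^marExp) < 10^(marExp+radExp)`.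
[folklore] -/
theorem RoundingCert.ineq_of_validHasse {c : RoundingCert} (h : c.validHasse = true) :
    8 * c.p * (c.marNum * 10 ^ c.radExp + c.radNum * 10 ^ c.marExp) < 10 ^ (c.marExp + c.radExp) := by
  simp only [RoundingCert.validHasse, Bool.and_eq_true, decide_eq_true_eq] at h
  exact h.2

/-- The rescaling identities of a `validHasse` certificate: `J_k · D = (D·C_k) · D'` for every zipped pair of
recorded bins. [folklore] -/
theorem RoundingCert.rescale_of_validHasse {c : RoundingCert} (h : c.validHasse = true) :
    ∀ ij ∈ c.bins.zip c.binsStar, ij.2 * (c.den : ℤ) = ij.1 * (c.dstar : ℤ) := by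
  simp only [RoundingCert.validHasse, Bool.and_eq_true, decide_eq_true_eq, List.all_eq_true, beq_iff_eq] at h
  exact h.1.2

variable {N : ℕ} [NeZero N] {f : CuspForm (Gamma0 N) 2}
  {W : WeierstrassCurve ℚ} [W.IsElliptic] [W.IsGloballyMinimal]

/-- **A `validHasse` ROW CERTIFIES EXACT ROUNDING** (`RoundingCert.sum_ratPlusSymbol_eq_div_of_ineq` of the
sibling file, fed with `ineq_of_validHasse`): newform `f` of `E = W` with good reduction at `c.p`,
`gcd(n, N) = 1`, `x = Σ_i w_i [a_i/n]⁺_f`, integer scale `D ≥ 1`, integer `J`, the engine's ball `mid ± rad ∋ D·x`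
with `rad ≤ radNum/10^radExp`, `|mid − J| ≤ marNum/10^marExp` ⟹ `x = J/D`. [cite: CremonaAlgorithms1997, §2.8 (2.8.8) (PDF p. 26)] -/
theorem RoundingCert.sum_ratPlusSymbol_eq_div_of_validHasse {c : RoundingCert} (hc : c.validHasse = true)
    [Fact c.p.Prime] (hf : IsNewformOf W f) (hgood : W.HasGoodReductionAtPrime c.p) {n : ℕ}
    (hn : Nat.Coprime n N) {ι : Type*} (S : Finset ι) (w a : ι → ℤ) {D : ℕ} (hD : 0 < D) {J : ℤ}
    {mid rad : ℝ}
    (hball : |(D : ℝ) * ((∑ i ∈ S, (w i : ℚ) * ratPlusSymbol f ((a i : ℚ) / n) : ℚ) : ℝ) - mid| ≤ rad)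
    (hrad : rad ≤ (c.radNum : ℝ) / 10 ^ c.radExp) (hmar : |mid - J| ≤ (c.marNum : ℝ) / 10 ^ c.marExp) :
    ∑ i ∈ S, (w i : ℚ) * ratPlusSymbol f ((a i : ℚ) / n) = J / D :=
  c.sum_ratPlusSymbol_eq_div_of_ineq (c.ineq_of_validHasse hc) hf hgood hn S w a hD hball hrad hmar

/-- Every schema-`valid` row whose bounds satisfy the sharper inequality is `validHasse` (the other conjuncts
are a subset of `valid`'s); this is how the 3 775 landed rows are read in the new currency without
re-issuing any record file. [folklore] -/
theorem RoundingCert.validHasse_of_valid {c : RoundingCert} (h : c.valid = true)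
    (hineq : 8 * c.p * (c.marNum * 10 ^ c.radExp + c.radNum * 10 ^ c.marExp) < 10 ^ (c.marExp + c.radExp)) :
    c.validHasse = true := by
  simp only [RoundingCert.valid, Bool.and_eq_true, decide_eq_true_eq] at h
  simp only [RoundingCert.validHasse, Bool.and_eq_true, decide_eq_true_eq]
  exact ⟨⟨⟨⟨⟨h.1.1.1.1.1.1.1.1, h.1.1.1.1.1.1.1.2⟩, h.1.1.1.1.1.1.2⟩, h.1.1.1.2⟩, h.1.2⟩, hineq⟩

/-- The schema SAMPLE (`KuriharaTwistRoundingSchema.roundingCertified_sample`: `43314b1` @ `5`, `n = 10291`,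
`D = 1`, `D' = 4`, margin `≤ 6.85·10⁻²⁰`, radius `≤ 6.55·10⁻¹²`) passes `validHasse`:
`40·(6.85·10⁻²⁰ + 6.55·10⁻¹²) < 1` (the kernel re-checks the cleared integer inequality). [folklore] -/
theorem roundingCertifiedHasse_sample : RoundingCertifiedHasse [
  { label := "43314b1", p := 5, n := 10291, den := 1, bins := [2134, -2968, 2134, -650, -650],
    torsion := 2, manin := 1, optimality := 1, dstar := 4, binsStar := [8536, -11872, 8536, -2600, -2600],
    marNum := 685, marExp := 22, radNum := 655, radExp := 14,
    evidence := ["impl3c j119592 impl3c-kurtw-cert/2026-08-21-g9-v1 prec=128 eps=1e-16 m0=17136944",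
      "bins = impl1 j102415 = impl2 j102669 = impl3 j114406"] } ] := by
  decide

/-- `validHasse` does NOT read the Manin/torsion fields: the sample re-issued at `D' = 2` (rejected by the
schema's `valid`, `not_roundingCertified_denominator`: `2` is not a multiple of `2·c·#E(ℚ)_tors = 4`) PASSES
here — in `f`-units the admissible denominators are governed by `2#Ẽ(𝔽_ℓ)` and absorbed by the inequality.
[folklore] -/
theorem roundingCertifiedHasse_denominator_two : RoundingCertifiedHasse [
  { label := "43314b1", p := 5, n := 10291, den := 1, bins := [2134, -2968, 2134, -650, -650],
    torsion := 2, manin := 1, optimality := 1, dstar := 2, binsStar := [4268, -5936, 4268, -1300, -1300],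
    marNum := 685, marExp := 22, radNum := 655, radExp := 14, evidence := [] } ] := by
  decide

/-- An honest radius that is too large is NOT a certificate here either: radius bound `0.03`
(`radNum = 3`, `radExp = 2`) fails `40·(margin + radius) < 1`. [folklore] -/
theorem not_roundingCertifiedHasse_wide : ¬ RoundingCertifiedHasse [
  { label := "43314b1", p := 5, n := 10291, den := 1, bins := [2134, -2968, 2134, -650, -650],
    torsion := 2, manin := 1, optimality := 1, dstar := 4, binsStar := [8536, -11872, 8536, -2600, -2600],
    marNum := 685, marExp := 22, radNum := 3, radExp := 2, evidence := [] } ] := by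
  decide

/-- A certificate whose rescaled integers do not reproduce the recorded bins is NOT valid here either:
changing `J_1` from `−11872` to `−11871` breaks `J_1 · D = (D·C_1) · D'`. [folklore] -/
theorem not_roundingCertifiedHasse_rescale : ¬ RoundingCertifiedHasse [
  { label := "43314b1", p := 5, n := 10291, den := 1, bins := [2134, -2968, 2134, -650, -650],
    torsion := 2, manin := 1, optimality := 1, dstar := 4, binsStar := [8536, -11871, 8536, -2600, -2600],
    marNum := 685, marExp := 22, radNum := 655, radExp := 14, evidence := [] } ] := by
  decide

end Check

end Summit.BirchSwinnertonDyer.Rank1Residual.Supersingular.KuriharaTwist
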